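import Mathlib
import Literature.NumberTheory.LFunctions.Zhang2022.Section7cProofs
import Literature.NumberTheory.LFunctions.Zhang2022.Section7bDischarges
import HarnessLib

/-!
# Zhang (2022) §7 (7.12): "changing the order of summation" — DAG node `Z22:(7.12)`, DISCHARGED

Topic `Literature/NumberTheory/LFunctions/Zhang2022` (Landau–Siegel audit tree; verdict-neutral).
Y. Zhang, *Discrete mean estimates and the Landau–Siegel zero*, arXiv:2211.02515v1 (2022)
[Zhang2022LandauSiegel] — **an unrefereed manuscript under adjudication** (D-0069 width campaign,
layer L2, discharge seat sz-d19, re-point LEDGER #9 (R26)). §7, proof of Proposition 7.1, part (b)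
(p. 37, tex L1984–L1995): "We now turn to `𝔗₁₂(p)`. Changing the order of summation gives
`Σ_{p∼P} p^{β₃}𝔗₁₂(p) = Σ_d (1/d) Σ_k a₂(dk)/(kφ(k)) Σ′_{θ mod k} τ(θ̄) Σ_l (κ∗a₁)(dl)θ(l)
 × Σ_{p∼P} p^{β₃}θ̄(−p)Δ(l/(pk))` (7.12)", typed by slice L2-t4 as `Section7cStatements.Eq712 c′`
over the interface stub `Iface.frakT12` (= the owner's `Section7bStatements.frakT12`,
`Iface.frakT12_eq`). This file PROVES it (`eq712_holds`), for every `D` beyond the threshold of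
Lemma 5.3 and every `𝐚₁, 𝐚₂` obeying (7.2) ((A) unused), supplying what "changing the order of
summation" needs: the `l`-series converge absolutely (`|(κ∗a₁)(dl)| ≤ B(dl)⁴`, `|Δ(x)|` super-
polynomially small for `x > t₀^{1.02}` — Lemma 5.3 (5.9), the tree's `Skeleton.lemma53_holds`, via
`Section7bStatements.summable_kappaConv_mul_DeltaW`), so the finite sums over `p`, `k` and `θ`
commute with the `l`-series (`Summable.tsum_finsetSum`, `tsum_mul_left`); the condition
`(k,l) = 1` of (7.9) is absorbed by `θ(l) = 0` for `l` not a unit mod `k`.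

WHAT THIS FILE IS NOT: a statement about (7.11), (7.13)–(7.15) or Theorems 1–2 / Landau–Siegel
zeros. No definitions, no new facts.

Provenance: proved by sz-d19 g0 (staged HOME/staging/L2/sz-d19/Section7cEq712.lean, sha16
ba99c21c37c06b95, farm-clean 02:11Z); filed verbatim by sz-d26 under L2 LEDGER #19 (R64).

## References

* Y. Zhang, arXiv:2211.02515v1 (2022), §7 (7.12) p. 37, tex L1984–L1995; (7.9); §5 Lemma 5.3.
  [cite: Zhang2022LandauSiegel, §7 (7.12) p.37]
-/

noncomputable section

open Complex Real Finset
open Literature.NumberTheory.LFunctions.Zhang2022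

namespace Literature.NumberTheory.LFunctions.Zhang2022.Section7cStatements

open scoped Classical

/-! ## Exchange lemmas: finite sums and constants through an `l`-series -/

/-- `Σ_{i∈s} a_i · Σ_l f_i(l) = Σ_l Σ_{i∈s} a_i f_i(l)` when each `f_i` is summable.
[cite: Zhang2022LandauSiegel, §7 (7.12) p.37] -/
theorem sum_mul_tsum_eq_tsum_sum {ι : Type*} (s : Finset ι) (a : ι → ℂ) (f : ι → ℕ → ℂ)
    (hf : ∀ i ∈ s, Summable (f i)) :
    ∑ i ∈ s, a i * ∑' l, f i l = ∑' l, ∑ i ∈ s, a i * f i l := by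
  rw [Summable.tsum_finsetSum (fun i hi => (hf i hi).mul_left (a i))]
  refine Finset.sum_congr rfl fun i _ => ?_
  rw [tsum_mul_left]

/-- `(if P then a · Σ_l f(l) else 0) = Σ_l (if P then a f(l) else 0)`.
[cite: Zhang2022LandauSiegel, §7 (7.12) p.37] -/
theorem ite_mul_tsum (P : Prop) [Decidable P] (a : ℂ) (f : ℕ → ℂ) :
    (if P then a * ∑' l, f l else 0) = ∑' l, (if P then a * f l else 0) := by
  by_cases hP : P
  · simp only [hP, if_true, tsum_mul_left]
  · simp only [hP, if_false, tsum_zero]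

/-! ## The pointwise identity behind (7.12) (finite sums only) -/

/-- The `θ`-weight `Σ′_{θ mod k} τ(θ̄)θ(l)θ̄(−p)` vanishes unless `(k,l) = 1` (`θ(l) = 0` for `l` a
non-unit mod `k`). [cite: Zhang2022LandauSiegel, §7 (7.12) p.37] -/
theorem thetaWeight_eq_zero_of_not_coprime {k l p : ℕ} (hk : 0 < k) (hkl : ¬ Nat.Coprime k l) :
    (∑ θ : DirichletCharacter ℂ k,
      if θ ≠ 1 then gaussBar k θ * θ (l : ZMod k) * θ⁻¹ (-(p : ZMod k)) else 0) = 0 := by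
  haveI : NeZero k := ⟨hk.ne'⟩
  refine Finset.sum_eq_zero fun θ _ => ?_
  have hl : θ (l : ZMod k) = 0 :=
    MulChar.map_nonunit _ (mt (ZMod.isUnit_iff_coprime l k).mp fun h => hkl h.symm)
  split_ifs
  · rw [hl, mul_zero, zero_mul]
  · rfl

/-- **(7.12) termwise in `(d, l)`**: for fixed `d, l`,
`Σ_{p∼P} p^{β₃} Σ_{k,(k,l)=1} (κ∗a₁)(dl) a₂(dk)/(kφ(k)) [Σ′_θ τ(θ̄)θ(l)θ̄(−p)] Δ(l/(pk))
 = Σ_k a₂(dk)/(kφ(k)) Σ′_θ τ(θ̄) (κ∗a₁)(dl)θ(l) Σ_{p∼P} p^{β₃}θ̄(−p)Δ(l/(pk))` (finite sums).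
[cite: Zhang2022LandauSiegel, §7 (7.12) p.37] -/
theorem eq712_pointwise (c' : ℝ) (D : ℕ) (a₁ a₂ : ℕ → ℂ) (d l : ℕ) :
    (∑ p ∈ Skeleton.primeWindow D, (p : ℂ) ^ Skeleton.beta3 c' D *
      ∑ k ∈ (Finset.Ico 1 (Skeleton.Nsupp D)).filter (fun k => Nat.Coprime k l),
        MeanSquareMajorant.conv (Skeleton.kappaZ c' D) a₁ (d * l) * a₂ (d * k) /
            ((k : ℂ) * (Nat.totient k : ℂ)) *
          (∑ θ : DirichletCharacter ℂ k,
            if θ ≠ 1 then gaussBar k θ * θ (l : ZMod k) * θ⁻¹ (-(p : ZMod k)) else 0) *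
          Skeleton.DeltaW D ((l : ℝ) / ((p : ℝ) * k))) =
    ∑ k ∈ Finset.Ico 1 (Skeleton.Nsupp D), a₂ (d * k) / ((k : ℂ) * (Nat.totient k : ℂ)) *
      ∑ θ : DirichletCharacter ℂ k,
        (if θ ≠ 1 then
          gaussBar k θ * (MeanSquareMajorant.conv (Skeleton.kappaZ c' D) a₁ (d * l) * θ (l : ZMod k) *
            ∑ p ∈ Skeleton.primeWindow D, (p : ℂ) ^ Skeleton.beta3 c' D *
              θ⁻¹ (-(p : ZMod k)) * Skeleton.DeltaW D ((l : ℝ) / ((p : ℝ) * k)))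
        else 0) := by
  -- drop the filter on the left: the θ-weight vanishes when `(k,l) ≠ 1`
  have hfilt : ∀ p ∈ Skeleton.primeWindow D,
      (∑ k ∈ (Finset.Ico 1 (Skeleton.Nsupp D)).filter (fun k => Nat.Coprime k l),
        MeanSquareMajorant.conv (Skeleton.kappaZ c' D) a₁ (d * l) * a₂ (d * k) /
            ((k : ℂ) * (Nat.totient k : ℂ)) *
          (∑ θ : DirichletCharacter ℂ k,
            if θ ≠ 1 then gaussBar k θ * θ (l : ZMod k) * θ⁻¹ (-(p : ZMod k)) else 0) *
          Skeleton.DeltaW D ((l : ℝ) / ((p : ℝ) * k))) =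
      ∑ k ∈ Finset.Ico 1 (Skeleton.Nsupp D),
        MeanSquareMajorant.conv (Skeleton.kappaZ c' D) a₁ (d * l) * a₂ (d * k) /
            ((k : ℂ) * (Nat.totient k : ℂ)) *
          (∑ θ : DirichletCharacter ℂ k,
            if θ ≠ 1 then gaussBar k θ * θ (l : ZMod k) * θ⁻¹ (-(p : ZMod k)) else 0) *
          Skeleton.DeltaW D ((l : ℝ) / ((p : ℝ) * k)) := by
    intro p _
    refine Finset.sum_filter_of_ne fun k hk hne => ?_
    by_contra hkl
    have hk0 : 0 < k := (Finset.mem_Ico.mp hk).1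
    rw [thetaWeight_eq_zero_of_not_coprime (p := p) hk0 hkl, mul_zero, zero_mul] at hne
    exact hne rfl
  rw [Finset.sum_congr rfl fun p hp => by rw [hfilt p hp]]
  -- distribute everything into triple sums of `ite`s
  simp only [Finset.mul_sum, mul_ite, mul_zero]
  rw [Finset.sum_comm]
  refine Finset.sum_congr rfl fun k _ => ?_
  simp only [Finset.sum_mul, ite_mul, zero_mul, Finset.mul_sum, mul_ite, mul_zero]
  rw [Finset.sum_comm]
  refine Finset.sum_congr rfl fun θ _ => ?_
  split_ifs with h1
  · refine Finset.sum_congr rfl fun p _ => ?_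
    ring
  · simp only [Finset.sum_const_zero]

/-! ## Bounds and summability of the `l`-series (Lemma 5.3 (5.9)) -/

/-- `|τ(θ̄)| ≤ k` for every character `θ (mod k)` (trivially, `|θ̄(a)e(a/k)| ≤ 1`).
[cite: Zhang2022LandauSiegel, §7 p.37] -/
theorem norm_gaussBar_le (k : ℕ) (θ : DirichletCharacter ℂ k) : ‖gaussBar k θ‖ ≤ k := by
  unfold gaussBar
  split_ifs with hk
  · simp
  · haveI : NeZero k := ⟨hk⟩
    show ‖gaussSum θ⁻¹ (ZMod.stdAddChar (N := k))‖ ≤ k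
    rw [gaussSum]
    calc ‖∑ a : ZMod k, θ⁻¹ a * ZMod.stdAddChar a‖
        ≤ ∑ a : ZMod k, ‖θ⁻¹ a * ZMod.stdAddChar a‖ := norm_sum_le _ _
      _ ≤ ∑ a : ZMod k, (1 : ℝ) := Finset.sum_le_sum fun a _ => by
          rw [norm_mul, AddChar.norm_apply, mul_one]
          exact DirichletCharacter.norm_le_one _ _
      _ = k := by simp

/-- The `θ`-weight is bounded: `|Σ′_θ τ(θ̄)θ(l)θ̄(−p)| ≤ #{θ mod k}·k`, uniformly in `l, p`.
[cite: Zhang2022LandauSiegel, §7 p.37] -/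
theorem norm_thetaWeight_le (k l p : ℕ) :
    ‖∑ θ : DirichletCharacter ℂ k,
        (if θ ≠ 1 then gaussBar k θ * θ (l : ZMod k) * θ⁻¹ (-(p : ZMod k)) else 0)‖ ≤
      (Fintype.card (DirichletCharacter ℂ k) : ℝ) * k := by
  calc ‖∑ θ : DirichletCharacter ℂ k,
          (if θ ≠ 1 then gaussBar k θ * θ (l : ZMod k) * θ⁻¹ (-(p : ZMod k)) else 0)‖
      ≤ ∑ θ : DirichletCharacter ℂ k,
          ‖(if θ ≠ 1 then gaussBar k θ * θ (l : ZMod k) * θ⁻¹ (-(p : ZMod k)) else 0)‖ :=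
        norm_sum_le _ _
    _ ≤ ∑ θ : DirichletCharacter ℂ k, (k : ℝ) := Finset.sum_le_sum fun θ _ => by
        split_ifs
        · rw [norm_mul, norm_mul]
          calc ‖gaussBar k θ‖ * ‖θ (l : ZMod k)‖ * ‖θ⁻¹ (-(p : ZMod k))‖ ≤ k * 1 * 1 :=
                mul_le_mul (mul_le_mul (norm_gaussBar_le k θ) (DirichletCharacter.norm_le_one _ _)
                  (norm_nonneg _) (Nat.cast_nonneg _)) (DirichletCharacter.norm_le_one _ _)
                  (norm_nonneg _) (by positivity)
            _ = k := by ring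
        · rw [norm_zero]; exact Nat.cast_nonneg _
    _ = (Fintype.card (DirichletCharacter ℂ k) : ℝ) * k := by
        rw [Finset.sum_const, nsmul_eq_mul, Finset.card_univ]

/-- `|p^{β₃}| = 1` for `p ≥ 1` (`β₃` is purely imaginary). [cite: Zhang2022LandauSiegel, §2 (2.13)] -/
theorem norm_natCast_cpow_beta3 (c' : ℝ) (D : ℕ) {p : ℕ} (hp : 0 < p) :
    ‖(p : ℂ) ^ Skeleton.beta3 c' D‖ = 1 := by
  have hp' : (0 : ℝ) < (p : ℝ) := by exact_mod_cast hp
  rw [show (p : ℂ) = ((p : ℝ) : ℂ) by norm_cast, Complex.norm_cpow_eq_rpow_re_of_pos hp',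
    Section7bStatements.beta3_re, Real.rpow_zero]

/-- The (5.9)-type decay of `Δ` beyond `t₀^{1.02}` (Lemma 5.3, the tree's `Skeleton.lemma53_holds`),
eventually in `D`. [cite: Zhang2022LandauSiegel, §5 Lemma 5.3 (5.9)] -/
theorem forAllLarge_DeltaW_decay : ∃ C5 : ℝ, Skeleton.ForAllLarge fun D _ _ =>
    ∀ x : ℝ, Skeleton.t0 D ^ (1.02 : ℝ) < x → ‖Skeleton.DeltaW D x‖ ≤
      C5 * (Real.exp (-((1 : ℝ) / 100 * Skeleton.ell2 D * Real.log x) ^ 2) +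
        Real.exp (-(x ^ (0.99 : ℝ)) / Skeleton.ell2 D)) := by
  obtain ⟨c5, -, C5, h53⟩ := Skeleton.lemma53_holds
  refine ⟨C5, h53.mono fun D _ χ _ _ h x hx => ?_⟩
  have hℓ : 0 ≤ Skeleton.ell D := by rw [Skeleton.ell]; exact Real.log_natCast_nonneg D
  have ht0 : 0 ≤ Skeleton.t0 D ^ (1.02 : ℝ) := Real.rpow_nonneg (by rw [Skeleton.t0]; positivity) _
  exact (h x (lt_of_le_of_lt ht0 hx)).2 hx

/-- Summability of `l ↦ (κ∗a₁)(dl)·g(l)·Δ(l/(pk))` for bounded `g` (`p, k ≥ 1`), given the decay of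
`Δ`: the tree's `Section7bStatements.summable_kappaConv_mul_DeltaW` in `conv`-form.
[cite: Zhang2022LandauSiegel, §5 (5.9)] -/
theorem summable_conv_mul_DeltaW {D : ℕ} {C5 : ℝ} (hℓ2 : 0 < Skeleton.ell2 D)
    (hΔ : ∀ x : ℝ, Skeleton.t0 D ^ (1.02 : ℝ) < x → ‖Skeleton.DeltaW D x‖ ≤
      C5 * (Real.exp (-((1 : ℝ) / 100 * Skeleton.ell2 D * Real.log x) ^ 2) +
        Real.exp (-(x ^ (0.99 : ℝ)) / Skeleton.ell2 D)))
    (c' : ℝ) {a₁ : ℕ → ℂ} {B : ℝ} (ha₁ : ∀ n, ‖a₁ n‖ ≤ B) (d : ℕ) {p k : ℕ} (hp : 0 < p)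
    (hk : 0 < k) (g : ℕ → ℂ) {G : ℝ} (hg : ∀ l, ‖g l‖ ≤ G) :
    Summable (fun l : ℕ => MeanSquareMajorant.conv (Skeleton.kappaZ c' D) a₁ (d * l) * g l *
      Skeleton.DeltaW D ((l : ℝ) / ((p : ℝ) * k))) := by
  have h := Section7bStatements.summable_kappaConv_mul_DeltaW (a := (1 : ℝ) / 100 * Skeleton.ell2 D)
    (by positivity) hℓ2 hΔ c' ha₁ d hp hk g hg
  rw [Section7bStatements.kappaConv_eq_conv] at h
  exact h

/-! ## (7.12) -/

/-- `Σ_{p} A(p)·Σ_{d} c(d)T(d,p) = Σ_{d} c(d)·Σ_{p} A(p)T(d,p)` (finite sums).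
[cite: Zhang2022LandauSiegel, §7 (7.12) p.37] -/
private theorem sum_mul_sum_comm (s t : Finset ℕ) (A c : ℕ → ℂ) (T : ℕ → ℕ → ℂ) :
    ∑ p ∈ s, A p * ∑ d ∈ t, c d * T d p = ∑ d ∈ t, c d * ∑ p ∈ s, A p * T d p := by
  simp only [Finset.mul_sum]
  rw [Finset.sum_comm]
  exact Finset.sum_congr rfl fun d _ => Finset.sum_congr rfl fun p _ => by ring

/-- **`Z22:(7.12)` DISCHARGED**: `Section7cStatements.Eq712 c′` holds — "changing the order of
summation" in `Σ_{p∼P} p^{β₃}𝔗₁₂(p)`, for all `D` beyond the threshold of Lemma 5.3 (and `≥ 3`) and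
all `𝐚₁, 𝐚₂` with (7.2). [cite: Zhang2022LandauSiegel, §7 (7.12) p.37, tex L1984–L1995] -/
theorem eq712_holds (c' : ℝ) : Eq712 c' := by
  intro B
  obtain ⟨C5, D5, h5⟩ := forAllLarge_DeltaW_decay
  refine ⟨max D5 3, fun D _ χ hD hq hpr _ a₁ a₂ ha₁ _ => ?_⟩
  have hD5 : D5 ≤ D := (le_max_left _ _).trans hD
  have hD3 : 3 ≤ D := (le_max_right _ _).trans hD
  have hΔ := h5 D χ hD5 hq hpr
  have hℓ : 0 < Skeleton.ell D := by
    rw [Skeleton.ell]; exact Real.log_pos (by exact_mod_cast (by omega : 1 < D))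
  have hℓ2 : 0 < Skeleton.ell2 D := by rw [Skeleton.ell2]; positivity
  have hPW : ∀ p ∈ Skeleton.primeWindow D, 0 < p :=
    fun p hp => (Finset.mem_filter.mp hp).2.pos
  -- summability of the left `l`-series (one for each `d`, `p`)
  have hSumL : ∀ d : ℕ, ∀ p ∈ Skeleton.primeWindow D, Summable fun l : ℕ =>
      ∑ k ∈ (Finset.Ico 1 (Skeleton.Nsupp D)).filter (fun k => Nat.Coprime k l),
          MeanSquareMajorant.conv (Skeleton.kappaZ c' D) a₁ (d * l) * a₂ (d * k) /
              ((k : ℂ) * (Nat.totient k : ℂ)) *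
            (∑ θ : DirichletCharacter ℂ k,
            if θ ≠ 1 then gaussBar k θ * θ (l : ZMod k) * θ⁻¹ (-(p : ZMod k)) else 0) *
            Skeleton.DeltaW D ((l : ℝ) / ((p : ℝ) * k)) := by
    intro d p hp
    have hp0 := hPW p hp
    simp_rw [Finset.sum_filter]
    refine summable_sum fun k hk => ?_
    have hk0 : 0 < k := (Finset.mem_Ico.mp hk).1
    have hs := summable_conv_mul_DeltaW hℓ2 hΔ c' ha₁.1 d hp0 hk0
      (fun l => (if Nat.Coprime k l then (1 : ℂ) else 0) * (a₂ (d * k) / ((k : ℂ) * (Nat.totient k : ℂ))) *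
        (∑ θ : DirichletCharacter ℂ k,
            if θ ≠ 1 then gaussBar k θ * θ (l : ZMod k) * θ⁻¹ (-(p : ZMod k)) else 0))
      (G := 1 * ‖a₂ (d * k) / ((k : ℂ) * (Nat.totient k : ℂ))‖ *
        ((Fintype.card (DirichletCharacter ℂ k) : ℝ) * k)) (fun l => by
        rw [norm_mul, norm_mul]
        refine mul_le_mul (mul_le_mul ?_ le_rfl (norm_nonneg _) zero_le_one)
          (norm_thetaWeight_le k l p) (norm_nonneg _) (by positivity)
        split_ifs <;> simp)
    refine hs.congr fun l => ?_
    split_ifs with hco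
    · ring
    · simp
  -- summability of the right `l`-series (one for each `d`, `k`, `θ`)
  have hSumR : ∀ d : ℕ, ∀ k ∈ Finset.Ico 1 (Skeleton.Nsupp D), ∀ θ : DirichletCharacter ℂ k,
      Summable fun l : ℕ =>
        (if θ ≠ 1 then
            gaussBar k θ * (MeanSquareMajorant.conv (Skeleton.kappaZ c' D) a₁ (d * l) * θ (l : ZMod k) *
              ∑ p ∈ Skeleton.primeWindow D, (p : ℂ) ^ Skeleton.beta3 c' D *
                θ⁻¹ (-(p : ZMod k)) * Skeleton.DeltaW D ((l : ℝ) / ((p : ℝ) * k)))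
          else 0) := by
    intro d k hk θ
    have hk0 : 0 < k := (Finset.mem_Ico.mp hk).1
    by_cases h1 : θ ≠ 1
    · simp only [if_pos h1]
      have hs : Summable fun l : ℕ => ∑ p ∈ Skeleton.primeWindow D,
          MeanSquareMajorant.conv (Skeleton.kappaZ c' D) a₁ (d * l) *
            (gaussBar k θ * θ (l : ZMod k) * (p : ℂ) ^ Skeleton.beta3 c' D * θ⁻¹ (-(p : ZMod k))) *
            Skeleton.DeltaW D ((l : ℝ) / ((p : ℝ) * k)) := by
        refine summable_sum fun p hp => ?_
        have hp0 := hPW p hp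
        exact summable_conv_mul_DeltaW hℓ2 hΔ c' ha₁.1 d hp0 hk0 _ (G := k * 1 * 1 * 1) fun l => by
          rw [norm_mul, norm_mul, norm_mul]
          refine mul_le_mul (mul_le_mul (mul_le_mul (norm_gaussBar_le k θ)
            (DirichletCharacter.norm_le_one _ _) (norm_nonneg _) (Nat.cast_nonneg _))
            (le_of_eq (norm_natCast_cpow_beta3 c' D hp0)) (norm_nonneg _) (by positivity))
            (DirichletCharacter.norm_le_one _ _) (norm_nonneg _) (by positivity)
      refine hs.congr fun l => ?_
      rw [Finset.mul_sum, Finset.mul_sum]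
      refine Finset.sum_congr rfl fun p _ => ?_
      ring
    · simp only [if_neg h1]
      exact summable_zero
  -- the right side, `d` fixed, as one `l`-series
  have key : ∀ d : ℕ,
      (∑ k ∈ Finset.Ico 1 (Skeleton.Nsupp D), a₂ (d * k) / ((k : ℂ) * (Nat.totient k : ℂ)) *
        ∑ θ : DirichletCharacter ℂ k,
          (if θ ≠ 1 then
            gaussBar k θ * ∑' l : ℕ, MeanSquareMajorant.conv (Skeleton.kappaZ c' D) a₁ (d * l) * θ (l : ZMod k) *
              ∑ p ∈ Skeleton.primeWindow D, (p : ℂ) ^ Skeleton.beta3 c' D *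
                θ⁻¹ (-(p : ZMod k)) * Skeleton.DeltaW D ((l : ℝ) / ((p : ℝ) * k))
          else 0)) =
      ∑' l : ℕ, ∑ k ∈ Finset.Ico 1 (Skeleton.Nsupp D), a₂ (d * k) / ((k : ℂ) * (Nat.totient k : ℂ)) *
        ∑ θ : DirichletCharacter ℂ k,
          (if θ ≠ 1 then
            gaussBar k θ * (MeanSquareMajorant.conv (Skeleton.kappaZ c' D) a₁ (d * l) * θ (l : ZMod k) *
              ∑ p ∈ Skeleton.primeWindow D, (p : ℂ) ^ Skeleton.beta3 c' D *
                θ⁻¹ (-(p : ZMod k)) * Skeleton.DeltaW D ((l : ℝ) / ((p : ℝ) * k)))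
          else 0) := by
    intro d
    calc (∑ k ∈ Finset.Ico 1 (Skeleton.Nsupp D), a₂ (d * k) / ((k : ℂ) * (Nat.totient k : ℂ)) *
        ∑ θ : DirichletCharacter ℂ k,
          (if θ ≠ 1 then
            gaussBar k θ * ∑' l : ℕ, MeanSquareMajorant.conv (Skeleton.kappaZ c' D) a₁ (d * l) * θ (l : ZMod k) *
              ∑ p ∈ Skeleton.primeWindow D, (p : ℂ) ^ Skeleton.beta3 c' D *
                θ⁻¹ (-(p : ZMod k)) * Skeleton.DeltaW D ((l : ℝ) / ((p : ℝ) * k))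
          else 0))
        = ∑ k ∈ Finset.Ico 1 (Skeleton.Nsupp D), a₂ (d * k) / ((k : ℂ) * (Nat.totient k : ℂ)) *
            ∑ θ : DirichletCharacter ℂ k, ∑' l : ℕ,
              (if θ ≠ 1 then
            gaussBar k θ * (MeanSquareMajorant.conv (Skeleton.kappaZ c' D) a₁ (d * l) * θ (l : ZMod k) *
              ∑ p ∈ Skeleton.primeWindow D, (p : ℂ) ^ Skeleton.beta3 c' D *
                θ⁻¹ (-(p : ZMod k)) * Skeleton.DeltaW D ((l : ℝ) / ((p : ℝ) * k)))
          else 0) := by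
          simp only [ite_mul_tsum]
      _ = ∑ k ∈ Finset.Ico 1 (Skeleton.Nsupp D), a₂ (d * k) / ((k : ℂ) * (Nat.totient k : ℂ)) *
            ∑' l : ℕ, ∑ θ : DirichletCharacter ℂ k,
              (if θ ≠ 1 then
            gaussBar k θ * (MeanSquareMajorant.conv (Skeleton.kappaZ c' D) a₁ (d * l) * θ (l : ZMod k) *
              ∑ p ∈ Skeleton.primeWindow D, (p : ℂ) ^ Skeleton.beta3 c' D *
                θ⁻¹ (-(p : ZMod k)) * Skeleton.DeltaW D ((l : ℝ) / ((p : ℝ) * k)))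
          else 0) :=
          Finset.sum_congr rfl fun k hk => by
            rw [← Summable.tsum_finsetSum fun θ _ => hSumR d k hk θ]
      _ = _ := sum_mul_tsum_eq_tsum_sum _ _ _ fun k hk => summable_sum fun θ _ => hSumR d k hk θ
  -- assemble
  unfold Iface.frakT12 innerSum712
  rw [sum_mul_sum_comm]
  refine Finset.sum_congr rfl fun d _ => ?_
  congr 1
  rw [sum_mul_tsum_eq_tsum_sum _ _ _ fun p hp => hSumL d p hp, key d]
  exact tsum_congr fun l => eq712_pointwise c' D a₁ a₂ d l

end Literature.NumberTheory.LFunctions.Zhang2022.Section7cStatements
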